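import Summits.AtomisticToContinuum.Crystallization.Theorems.ExcessDecayLiouvilleHcpLiouvilleBlowdownCaccioppoli

/-!
# `ExcessDecayLiouville.HcpLiouville` (stmt-AtomisticToContinuum-9332), line `Sketch` (skeleton v5.2): stub `stub_caccioppoli_own`

Interface (C) of the blow-down, `Blowdown.CaccioppoliProp (1/20) C` (the nonlinear Caccioppoli inequality with a
COMMON constant subtracted), from the OWN-FIELD secant inequality at anchor radius `1/20`: for every admissible
hcp-like datum `(t, A)`, anchor `‖τ‖ ≤ 1/20` with hcp-like anchored datum whose sites are in force balance, every
field `v` on the anchored sites `S* = Sites₀ (anchorDatum t τ) A` with endpoints in the `1/40`-box, every centre `c`,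
radius `R ≥ 1` and constant `‖m‖ ≤ 1`,
`κ₁ · nnForm (anchorDatum t τ) A (χ•(v − m)) ≤ ½ · secFormAt (anchorDatum t τ) A v (χ•(v − m))`, `χ = LevelOne.cutoff S* c R`.

This is exactly the one instance of ray-secant coercivity `SecantCoercive ρ κ₁` that the landed proof of
`stub_caccioppoli` (`…HcpLiouvilleBlowdownCaccioppoli.lean`) consumes, in `Blowdown.nnForm_cutoff_sub_le`, with the test
field `χ•(v − m)`, `v = LevelOne.vField t A τ u`.  The three results of that file downstream of the coercivity
hypothesis are re-proved here with the hypothesis replaced by that instance: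

* `Blowdown.nnForm_cutoff_sub_le_own` — `κ₁·nnForm (χ•(v − m)) ≤ K₀R⁻²·oscAt S* v c (3R) m + 155·K₀R⁻²`
  from the instance at radius `R` and the landed `Blowdown.secFormAt_cutoff_sub_le`;
* `Blowdown.nnEnergy_le_main_own` — the estimate at a general cut-off radius `R'` (`1 ≤ R'`, `R + 11/10 ≤ R'`) by the
  landed read-out `Blowdown.nnEnergy_le_nnForm`;
* `stub_caccioppoli_own` — cut-off radius `R' = 4R/3` for `R ≥ 4` (`3R' = 4R`), `R' = R + 2` and the counting bound
  `oscAt(3R') ≤ (121/100)·32·18³` for `1 ≤ R < 4`; `C = 230000·K₀/κ₁`; the box hypothesis of the own-field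
  inequality is `LevelOne.vField_add_shiftField` + `IsDisplacement`.

All `[folklore]`; a `--supports` helper for item stmt-AtomisticToContinuum-9332, nothing here closes an item.
-/
noncomputable section

namespace Summit.AtomisticToContinuum.Crystallization.Theorems.ExcessDecayLiouville

open scoped BigOperators Topology Classical InnerProductSpace RealInnerProductSpace
open Literature.MathematicalPhysics.StatisticalMechanics
open Summit.AtomisticToContinuum.Crystallization.Theses.ExcessDecayLiouville
open Summit.AtomisticToContinuum.Crystallization.Theorems.PhononStabilityNegative

local notation "E3" => EuclideanSpace ℝ (Fin 3)

namespace Blowdown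

open LevelOne

variable {t : Fin 2 → E3} {A : E3 →L[ℝ] E3} {τ : E3} {X : Set E3} {u : E3 → E3}

/-! ## Coercivity instance on the cut-off field `χ • (v − m)` -/

/-- **Own-field coercivity applied to the cut-off field `χ•(v − m)`**: if
`κ₁·nnForm (anchorDatum t τ) A (χ•(v − m)) ≤ ½·secFormAt (anchorDatum t τ) A v (χ•(v − m))` for
`v = LevelOne.vField t A τ u`, `χ = cutoff S* c R`, then
`κ₁·nnForm (anchorDatum t τ) A (χ•(v − m)) ≤ K₀R⁻²·oscAt S* v c (3R) m + 155·K₀R⁻²`. [folklore] -/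
theorem nnForm_cutoff_sub_le_own {κ₁ : ℝ} (hA : Adm₀ A) (hI : Inner₀ t A)
    (hIτ : Inner₀ (anchorDatum t τ) A) (hEτ : Equil₀ (Sites₀ (anchorDatum t τ) A))
    (hu : IsDisplacement X t A u) (hEX : Equil₀ X) (c : E3) {R : ℝ} (hR : 1 ≤ R) {m : E3} (hm : ‖m‖ ≤ 1)
    (h : κ₁ * nnForm (anchorDatum t τ) A
        (fun p => cutoff (Sites₀ (anchorDatum t τ) A) c R p • (vField t A τ u p - m)) ≤
      secFormAt (anchorDatum t τ) A (vField t A τ u)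
        (fun p => cutoff (Sites₀ (anchorDatum t τ) A) c R p • (vField t A τ u p - m)) / 2) :
    κ₁ * nnForm (anchorDatum t τ) A
        (fun p => cutoff (Sites₀ (anchorDatum t τ) A) c R p • (vField t A τ u p - m)) ≤
      K₀ * (R⁻¹) ^ 2 * oscAt (Sites₀ (anchorDatum t τ) A) (vField t A τ u) c (3 * R) m +
        155 * K₀ * (R⁻¹) ^ 2 := by
  have h2 := secFormAt_cutoff_sub_le hA hI hIτ hu hEX hEτ c hR hm
  have h3 := div_le_div_of_nonneg_right h2 (by norm_num : (0 : ℝ) ≤ 2)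
  refine (h.trans h3).trans (le_of_eq ?_)
  ring

/-! ## The estimate at a general cut-off radius -/

/-- **The Caccioppoli estimate at cut-off radius `R'`** (own-field form): for `1 ≤ R'`, `R + 11/10 ≤ R'`,
`‖m‖ ≤ 1`, `0 ≤ κ₁`, the own-field coercivity instance at radius `R'` gives
`κ₁·nnEnergy S* v c R ≤ K₀R'⁻²·oscAt S* v c (3R') m + 155·K₀R'⁻²`. [folklore] -/
theorem nnEnergy_le_main_own {κ₁ : ℝ} (hκ₁ : 0 ≤ κ₁) (hA : Adm₀ A) (hI : Inner₀ t A)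
    (hIτ : Inner₀ (anchorDatum t τ) A) (hEτ : Equil₀ (Sites₀ (anchorDatum t τ) A))
    (hu : IsDisplacement X t A u) (hEX : Equil₀ X) (c : E3) {R R' : ℝ} (hR' : 1 ≤ R')
    (hRR' : R + 11 / 10 ≤ R') {m : E3} (hm : ‖m‖ ≤ 1)
    (h : κ₁ * nnForm (anchorDatum t τ) A
        (fun p => cutoff (Sites₀ (anchorDatum t τ) A) c R' p • (vField t A τ u p - m)) ≤
      secFormAt (anchorDatum t τ) A (vField t A τ u)
        (fun p => cutoff (Sites₀ (anchorDatum t τ) A) c R' p • (vField t A τ u p - m)) / 2) :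
    κ₁ * nnEnergy (Sites₀ (anchorDatum t τ) A) (vField t A τ u) c R ≤
      K₀ * (R'⁻¹) ^ 2 * oscAt (Sites₀ (anchorDatum t τ) A) (vField t A τ u) c (3 * R') m +
        155 * K₀ * (R'⁻¹) ^ 2 := by
  have h1 := nnEnergy_le_nnForm hA hIτ u c m (by linarith) hRR'
  have h2 := nnForm_cutoff_sub_le_own hA hI hIτ hEτ hu hEX c hR' hm h
  exact (mul_le_mul_of_nonneg_left h1 hκ₁).trans h2

end Blowdown

/-- **Stub `stub_caccioppoli_own` (line `Sketch`, skeleton v5.2, interface (C))**: the nonlinear Caccioppoli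
inequality with a common constant subtracted, `Blowdown.CaccioppoliProp (1/20) C` with `C = 230000·K₀/κ₁`, from the
OWN-FIELD secant inequality at anchor radius `1/20` (coercivity of the ray-secant form of `v` on the cut-off fields
`χ•(v − m)` of `v` itself) — for `R ≥ 4` the cut-off radius `4R/3` (`3·(4R/3) = 4R`), for `1 ≤ R < 4` the cut-off
radius `R + 2` and the counting bound `oscAt(3R + 6) ≤ (121/100)·32·18³`. [folklore] -/
theorem stub_caccioppoli_own :
    ∀ κ₁ : ℝ, 0 < κ₁ →
      (∀ (t : Fin 2 → E3) (A : E3 →L[ℝ] E3) (τ : E3), Adm₀ A → Inner₀ t A → ‖τ‖ ≤ 1 / 20 →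
        Inner₀ (anchorDatum t τ) A → Equil₀ (Sites₀ (anchorDatum t τ) A) →
        ∀ v : E3 → E3, (∀ s ∈ Sites₀ (anchorDatum t τ) A, ‖v s + shiftField (anchorDatum t τ) A τ s‖ ≤ 1 / 40) →
          ∀ (c : E3) (R : ℝ) (m : E3), 1 ≤ R → ‖m‖ ≤ 1 →
            κ₁ * nnForm (anchorDatum t τ) A
                (fun p => LevelOne.cutoff (Sites₀ (anchorDatum t τ) A) c R p • (v p - m)) ≤
              secFormAt (anchorDatum t τ) A v
                (fun p => LevelOne.cutoff (Sites₀ (anchorDatum t τ) A) c R p • (v p - m)) / 2) →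
      ∃ C : ℝ, Blowdown.CaccioppoliProp (1 / 20) C := by
  intro κ₁ hκ₁ hown
  refine ⟨230000 * LevelOne.K₀ / κ₁, ?_⟩
  intro X t A u τ hA hI hEX hu hρ hIτ hEτ c R m hR hm
  have hK := LevelOne.K₀_pos
  have hR0 : 0 < R := by linarith
  -- the endpoint configuration of `v = vField t A τ u` lies in the `1/40`-box of the original datum
  have hbox : ∀ s ∈ Sites₀ (anchorDatum t τ) A,
      ‖LevelOne.vField t A τ u s + shiftField (anchorDatum t τ) A τ s‖ ≤ 1 / 40 :=
    fun s hs => by rw [LevelOne.vField_add_shiftField]; exact hu.1 _ (LevelOne.bwd_mem hA hIτ hs)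
  -- the own-field inequality at every cut-off radius `R' ≥ 1`
  have hinst : ∀ R' : ℝ, 1 ≤ R' →
      κ₁ * nnForm (anchorDatum t τ) A
          (fun p => LevelOne.cutoff (Sites₀ (anchorDatum t τ) A) c R' p • (LevelOne.vField t A τ u p - m)) ≤
        secFormAt (anchorDatum t τ) A (LevelOne.vField t A τ u)
          (fun p => LevelOne.cutoff (Sites₀ (anchorDatum t τ) A) c R' p • (LevelOne.vField t A τ u p - m)) / 2 :=
    fun R' hR' => hown t A τ hA hI hρ hIτ hEτ (LevelOne.vField t A τ u) hbox c R' m hR' hm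
  set N := Blowdown.nnEnergy (Sites₀ (anchorDatum t τ) A) (LevelOne.vField t A τ u) c R with hN
  set O := Blowdown.oscAt (Sites₀ (anchorDatum t τ) A) (LevelOne.vField t A τ u) c (4 * R) m with hO
  have hO0 : 0 ≤ O := Blowdown.oscAt_nonneg _ _ _ _ _
  have hX0 : 0 ≤ (R⁻¹) ^ 2 := by positivity
  have h7 : 0 ≤ LevelOne.K₀ * (R⁻¹) ^ 2 * O := mul_nonneg (mul_nonneg hK.le hX0) hO0
  have h8 : 0 ≤ LevelOne.K₀ * (R⁻¹) ^ 2 := mul_nonneg hK.le hX0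
  have hfin : κ₁ * N ≤ LevelOne.K₀ * (R⁻¹) ^ 2 * O + 226000 * LevelOne.K₀ * (R⁻¹) ^ 2 := by
    by_cases h4 : 4 ≤ R
    · have key := Blowdown.nnEnergy_le_main_own hκ₁.le hA hI hIτ hEτ hu hEX c (R := R) (R' := 4 * R / 3)
        (by linarith) (by linarith) hm (hinst (4 * R / 3) (by linarith))
      have h3 : 3 * (4 * R / 3) = 4 * R := by ring
      rw [h3] at key
      have hinv : ((4 * R / 3)⁻¹) ^ 2 ≤ (R⁻¹) ^ 2 :=
        pow_le_pow_left₀ (inv_nonneg.2 (by positivity)) (inv_anti₀ hR0 (by linarith)) 2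
      have h5 : LevelOne.K₀ * ((4 * R / 3)⁻¹) ^ 2 * O ≤ LevelOne.K₀ * (R⁻¹) ^ 2 * O :=
        mul_le_mul_of_nonneg_right (mul_le_mul_of_nonneg_left hinv hK.le) hO0
      have h6 : 155 * LevelOne.K₀ * ((4 * R / 3)⁻¹) ^ 2 ≤ 155 * LevelOne.K₀ * (R⁻¹) ^ 2 :=
        mul_le_mul_of_nonneg_left hinv (by positivity)
      linarith
    · push Not at h4
      have key := Blowdown.nnEnergy_le_main_own hκ₁.le hA hI hIτ hEτ hu hEX c (R := R) (R' := R + 2)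
        (by linarith) (by linarith) hm (hinst (R + 2) (by linarith))
      have hosc : Blowdown.oscAt (Sites₀ (anchorDatum t τ) A) (LevelOne.vField t A τ u) c (3 * (R + 2)) m ≤
          121 / 100 * (32 * (3 * (R + 2)) ^ 3) :=
        Blowdown.oscAt_le_of_sq_le hA hIτ _ (fun p hp => Blowdown.sq_norm_vField_sub_const_le hA hI hIτ hu hm hp)
          (by norm_num) c (by linarith)
      have hcube : (3 * (R + 2)) ^ 3 ≤ (18 : ℝ) ^ 3 := pow_le_pow_left₀ (by linarith) (by linarith) 3
      have hY0 : 0 ≤ ((R + 2)⁻¹) ^ 2 := by positivity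
      have hinv : ((R + 2)⁻¹) ^ 2 ≤ (R⁻¹) ^ 2 :=
        pow_le_pow_left₀ (inv_nonneg.2 (by linarith)) (inv_anti₀ hR0 (by linarith)) 2
      have hosc' : Blowdown.oscAt (Sites₀ (anchorDatum t τ) A) (LevelOne.vField t A τ u) c (3 * (R + 2)) m ≤
          225816 := by nlinarith
      have h9 : LevelOne.K₀ * ((R + 2)⁻¹) ^ 2 *
          Blowdown.oscAt (Sites₀ (anchorDatum t τ) A) (LevelOne.vField t A τ u) c (3 * (R + 2)) m ≤
          LevelOne.K₀ * ((R + 2)⁻¹) ^ 2 * 225816 :=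
        mul_le_mul_of_nonneg_left hosc' (mul_nonneg hK.le hY0)
      have h10 : LevelOne.K₀ * ((R + 2)⁻¹) ^ 2 ≤ LevelOne.K₀ * (R⁻¹) ^ 2 := mul_le_mul_of_nonneg_left hinv hK.le
      linarith
  rw [div_mul_eq_mul_div, le_div_iff₀ hκ₁]
  linarith

end Summit.AtomisticToContinuum.Crystallization.Theorems.ExcessDecayLiouville

end
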